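import Literature.RingTheory.MvPowerSeries.MaximalIdealPow
import HarnessLib

/-!
# Multiplicity `≥ p` at `k + 1` successive infinitely near points along a smooth branch forces the equation into
# `(branch ideal)^p + 𝔪^{p+k}` — the formal (power-series) form

Topic: `Literature/AlgebraicGeometry/Resolution`. Let `G ∈ K⟦X⟧` (finitely many variables `σ`, one CHART variable `t = X i₀`, the
others `v = (X_i)_{i ≠ i₀}` cutting out the smooth branch `C = {v = 0}`). Blowing up the origin `k` times and following the strict
transforms of `C` (the `t`-chart origins) replaces `G` by `G_k = t^{-kp}·G(t, t^k v)` whenever the multiplicity stays `≥ p`; on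
monomials `t^a v^β ↦ t^{a + k|β| − kp} v^β`. So «`G_k` is a genuine series of order `≥ p`» reads, monomial by monomial,
`a + (k+1)|β| ≥ (k+1)p` (the divisorial valuation of the `(k+1)`-st infinitely near point of `C` is the monomial valuation with
weights `(1; k+1, …, k+1)` and `ν(G) ≥ (k+1)p`). THIS FILE proves the consequence that termination arguments consume:

* `mem_pow_span_X_sup_maximalIdeal_pow_of_coeff` — if every monomial `t^a v^β` of `G` with `|β| < p` has total degree `≥ M`,
  then `G ∈ (v)^p + 𝔪^M` (polynomial truncation + `Literature.RingTheory.MvPowerSeries.Jets`);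
* `mem_pow_span_X_sup_maximalIdeal_pow_of_weight` — **if every monomial of `G` satisfies `a + (k+1)|β| ≥ (k+1)p` then
  `G ∈ (v)^p + 𝔪^{p+k}`**: `k + 1` equimultiple free points in a row make the equation a `p`-th power of the branch ideal up to
  precision `p + k`. Combined with the APPROXIMATE EXIT at an isolated `p`-fold point (`IsolatedOrderPointApproximate.lean`:
  `J ⊆ 𝔞^p + 𝔪^N` forces `𝔞` to be `𝔪`-primary), free equimultiple runs from a point `ξ` have length `< N(ξ)` — with no formal
  limit and no completion prime.

Why (index only): W4.6 rung (iii) of the campaign `res-hironaka` (purely inseparable surface window; and its non-purely-inseparable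
extension, where the same finite-run principle applies verbatim since nothing here depends on the shape of `G`). Nothing of Hironaka's
2017 manuscript is used or asserted. Sources for the classical statements (infinitely near points along a smooth branch, monomial
valuations): [ZariskiSamuel1960] Vol. II Ch. VIII §§10–11 and App. 5; [CasasAlvero2000] §§3.2–3.3, 4.2.
-/

noncomputable section

namespace Literature.AlgebraicGeometry.Resolution

open MvPowerSeries Finsupp IsLocalRing
open Literature.RingTheory.MvPowerSeries.Jets

universe u v

variable {σ : Type u} [Fintype σ] [DecidableEq σ] {K : Type v} [Field K]

/-! ## §1 Monomials: `v`-degree and membership in `(v)^p` -/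

/-- A polynomial monomial `X^e` with `v`-degree `≥ b` lies in `(X_i : i ≠ i₀)^b` (peel off one `v`-variable at a time).
[cite: ZariskiSamuel1960, Vol. II Ch. VII §2 (monomial ideals; kernel bookkeeping)] -/
theorem monomial_mem_pow_span_X_ne (i₀ : σ) :
    ∀ (b : ℕ) (e : σ →₀ ℕ), b ≤ e.degree - e i₀ →
      (MvPolynomial.monomial e (1 : K)) ∈ Ideal.span ((fun i => (MvPolynomial.X i : MvPolynomial σ K)) '' {i | i ≠ i₀}) ^ b := by
  intro b
  induction b with
  | zero => intro e _; rw [pow_zero, Ideal.one_eq_top]; exact Submodule.mem_top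
  | succ b ih =>
    intro e he
    -- some variable other than `i₀` occurs in `e`
    have hex : ∃ i, i ≠ i₀ ∧ 1 ≤ e i := by
      by_contra h
      push Not at h
      have he' : e = Finsupp.single i₀ (e i₀) := by
        ext j
        by_cases hj : j = i₀
        · subst hj; simp
        · have := h j hj
          simp [Ne.symm hj]
          omega
      have hdeg : e.degree = e i₀ := by
        conv_lhs => rw [he']
        exact Finsupp.degree_single _ _
      omega
    obtain ⟨i, hi, hei⟩ := hex
    have hsplit : (MvPolynomial.monomial e (1 : K)) =
        MvPolynomial.X i * MvPolynomial.monomial (e - Finsupp.single i 1) 1 := by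
      rw [MvPolynomial.X, MvPolynomial.monomial_mul, one_mul,
        add_tsub_cancel_of_le (Finsupp.single_le_iff.mpr (by simpa using hei))]
    rw [hsplit, pow_succ']
    refine Ideal.mul_mem_mul (Ideal.subset_span ⟨i, hi, rfl⟩) (ih _ ?_)
    -- the `v`-degree drops by exactly one
    have h1 : (e - Finsupp.single i 1).degree + 1 = e.degree := by
      have h := tsub_add_cancel_of_le (Finsupp.single_le_iff.mpr (show 1 ≤ e i by simpa using hei))
      conv_rhs => rw [← h]
      rw [map_add, Finsupp.degree_single]
    have h2 : (e - Finsupp.single i 1 : σ →₀ ℕ) i₀ = e i₀ := by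
      simp [hi]
    omega

/-! ## §2 Power series: `(v)^p + 𝔪^M` from the monomials -/

/-- **`G ∈ (v)^p + 𝔪^M` as soon as every monomial `t^a v^β` of `G` with `|β| < p` has total degree `≥ M`** (`σ` finite, `K` a field;
`(v) = (X_i : i ≠ i₀)`): truncate `G` below degree `M` (`G ≡ truncTotal M G mod 𝔪^M`, tree `Jets.sub_coe_truncTotal_mem_maximalIdeal_pow`);
every surviving monomial has `v`-degree `≥ p`, hence lies in `(v)^p`. [cite: ZariskiSamuel1960, Vol. II Ch. VII §2 (monomial ideals)] -/
theorem mem_pow_span_X_sup_maximalIdeal_pow_of_coeff (i₀ : σ) {p M : ℕ} {G : MvPowerSeries σ K}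
    (h : ∀ e : σ →₀ ℕ, MvPowerSeries.coeff e G ≠ 0 → e.degree - e i₀ < p → M ≤ e.degree) :
    G ∈ Ideal.span ((fun i => (MvPowerSeries.X i : MvPowerSeries σ K)) '' {i | i ≠ i₀}) ^ p ⊔
      maximalIdeal (MvPowerSeries σ K) ^ M := by
  classical
  set T : MvPolynomial σ K := MvPowerSeries.truncTotal M G with hT
  -- `G = T + (G - T)`, the second summand in `𝔪^M`
  have hsplit : G = (T : MvPowerSeries σ K) + (G - (T : MvPowerSeries σ K)) := by ring
  rw [hsplit]
  refine Ideal.add_mem _ (Ideal.mem_sup_left ?_) (Ideal.mem_sup_right (sub_coe_truncTotal_mem_maximalIdeal_pow M G))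
  -- the truncation lies in `(v)^p` already as a polynomial
  have hpoly : T ∈ Ideal.span ((fun i => (MvPolynomial.X i : MvPolynomial σ K)) '' {i | i ≠ i₀}) ^ p := by
    rw [T.as_sum]
    refine Submodule.sum_mem _ fun e he => ?_
    have hc : MvPolynomial.coeff e T ≠ 0 := MvPolynomial.mem_support_iff.mp he
    have hdeg : e.degree < M := by
      by_contra hge
      exact hc (by rw [hT, MvPowerSeries.coeff_truncTotal_eq_zero _ (not_lt.mp hge)])
    have hG : MvPowerSeries.coeff e G ≠ 0 := by
      rwa [hT, MvPowerSeries.coeff_truncTotal _ hdeg] at hc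
    have hv : p ≤ e.degree - e i₀ := by
      by_contra hlt
      exact absurd (h e hG (not_le.mp hlt)) (not_le.mpr hdeg)
    have h1 : MvPolynomial.monomial e (MvPolynomial.coeff e T) =
        MvPolynomial.C (MvPolynomial.coeff e T) * MvPolynomial.monomial e 1 := by
      rw [MvPolynomial.C_mul_monomial, mul_one]
    rw [h1]
    exact Ideal.mul_mem_left _ _ (monomial_mem_pow_span_X_ne i₀ p e hv)
  have hmap := Ideal.mem_map_of_mem
    (MvPolynomial.coeToMvPowerSeries.ringHom : MvPolynomial σ K →+* MvPowerSeries σ K) hpoly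
  rw [Ideal.map_pow, Ideal.map_span, ← Set.image_comp] at hmap
  have hfun : ((MvPolynomial.coeToMvPowerSeries.ringHom : MvPolynomial σ K →+* MvPowerSeries σ K) ∘
      fun i => (MvPolynomial.X i : MvPolynomial σ K)) = fun i => (MvPowerSeries.X i : MvPowerSeries σ K) := by
    funext i
    simp
  rw [hfun] at hmap
  simpa using hmap

/-! ## §3 The weight form: `k + 1` equimultiple free points along the branch -/

/-- **`k + 1` equimultiple infinitely near points along a smooth branch ⇒ `p`-th power of the branch ideal up to precision `p + k`.**
If every monomial `t^a v^β` of `G` satisfies `a + (k+1)·|β| ≥ (k+1)·p` — i.e. `t^{-kp}·G(t, t^k v)` is a power series of order `≥ p`,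
which is what «the strict (= `p`-controlled) transforms of `G` have multiplicity `≥ p` at the first `k + 1` points of the branch
`C = {v = 0}`» says — then `G ∈ (v)^p + 𝔪^{p+k}`: a monomial with `|β| < p` has `a ≥ (k+1)(p − |β|) ≥ (p − |β|) + k`.
[cite: ZariskiSamuel1960, Vol. II App. 5 (infinitely near points and quadratic transformations)]
[cite: CasasAlvero2000, §3.2 and §4.2 (free points on a smooth branch; values of the divisorial valuations)] -/
theorem mem_pow_span_X_sup_maximalIdeal_pow_of_weight (i₀ : σ) {p k : ℕ} {G : MvPowerSeries σ K}
    (h : ∀ e : σ →₀ ℕ, MvPowerSeries.coeff e G ≠ 0 → (k + 1) * p ≤ e i₀ + (k + 1) * (e.degree - e i₀)) :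
    G ∈ Ideal.span ((fun i => (MvPowerSeries.X i : MvPowerSeries σ K)) '' {i | i ≠ i₀}) ^ p ⊔
      maximalIdeal (MvPowerSeries σ K) ^ (p + k) := by
  refine mem_pow_span_X_sup_maximalIdeal_pow_of_coeff i₀ fun e he hs => ?_
  have hw := h e he
  have hdeg : e.degree - e i₀ + e i₀ = e.degree := Nat.sub_add_cancel (Finsupp.le_degree i₀ e)
  -- with `s = |β| < p` and `a = e i₀`: `a ≥ (k+1)(p - s) ≥ (p - s) + k`
  set s := e.degree - e i₀ with hs_def
  set a := e i₀ with ha_def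
  have h1 : (k + 1) * (p - s) ≤ a := by
    rw [Nat.mul_sub]
    omega
  have h2 : (p - s) + k * 1 ≤ (k + 1) * (p - s) := by
    have : k * 1 ≤ k * (p - s) := Nat.mul_le_mul_left k (by omega)
    nlinarith
  omega

end Literature.AlgebraicGeometry.Resolution

end
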